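import Summits.PneNP.PneNP.Theorems.PseudorandomTwinsAbove.Negative.EscapeAndJunk
import Summits.PneNP.PneNP.Theorems.PseudorandomTwinsAbove.Negative.SetwiseToTV

/-!
# Route PhaseTwins, crux `PseudorandomTwinsAbove` (stmt-PneNP-2721) — negative side: vertex counts and thresholds escape

Continuation of `Negative/RegularTests.lean` and `Negative/EscapeAndJunk.lean` (crux
stmt-PneNP-2721, `Summit.PneNP.PneNP.Theses.PhaseTwins.PseudorandomTwinsAbove`; disprover's work
file `Summits/PneNP/PneNP/Cruxes/PseudorandomTwinsAbove/Disproof.lean`, cycle 2).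

Structure of the graph code `encodingGraph` (pair `⟨encodeNat n, n² adjacency bits⟩`):

* `decode_eq_some`: a string decodes to `⟨n, G⟩` only if its first pair component decodes to `n`
  and its payload has length `n²`; `length_le_decodeNat`: `|u| ≤ decodeNat u`;
  `length_eq_of_boolUnpair_snd_ne_nil`: a pair with non-empty payload has length `2|u| + 2 + |v|`.
  Hence `fewVertexCodes_finite`: for every `M` only finitely many strings decode to a graph on
  `1 ≤ n ≤ M` vertices, and `zeroVertexCodes_subset`: the strings decoding to the `0`-vertex graph
  are the junk cylinder `10{0,1}*` plus strings of length `≤ 2`.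

Consequences for every witness `(D₀, D₁, t)` of the crux (clauses (i)+(ii) with the crux's `N`):

* `vertexCount_escapes`: for every `M`, the event "the sample decodes to a graph on `≤ M`
  vertices" has vanishing mass under BOTH ensembles (tiny instances are allowed by the typed,
  index-free clause (i) — but they must grow without bound);
* `threshold_tendsto_atTop`: the threshold sequence satisfies `t n → ∞` (given `0 < p`, `0 < q`,
  which `guard_pos` derives from the crux's guard): NO-instances of bounded hard-core count are
  impossible, because a valid code on `n ≥ 1` vertices has `N ≥ n` (`vertexCount_le_hardcoreSum`).
-/

namespace Summit.PneNP.PneNP.Theorems.PseudorandomTwinsAbove.Negative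

open Literature.Computability.Complexity Literature.Computability.MetaComplexity
open Filter Topology
open scoped ENNReal

noncomputable section

/-! ## Arithmetic of the code -/

/-- `decodePosNum` dominates the length of its input. [folklore] -/
theorem length_le_decodePosNum : ∀ l : List Bool, l.length ≤ (Computability.decodePosNum l : ℕ)
  | [] => by simp
  | false :: l => by
    have ih := length_le_decodePosNum l
    have hpos := PosNum.to_nat_pos (Computability.decodePosNum l)
    simp only [Computability.decodePosNum, PosNum.cast_bit0, List.length_cons]
    omega
  | true :: l => by
    have ih := length_le_decodePosNum l
    have hpos := PosNum.to_nat_pos (Computability.decodePosNum l)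
    simp only [Computability.decodePosNum, List.length_cons]
    split_ifs with h
    · subst h; simp
    · simp only [PosNum.cast_bit1]
      omega

/-- `|u| ≤ decodeNat u` (binary with the least significant bit first, the empty tail standing
for the leading `1`). [folklore] -/
theorem length_le_decodeNat (u : List Bool) : u.length ≤ Computability.decodeNat u := by
  unfold Computability.decodeNat Computability.decodeNum
  split_ifs with h
  · subst h; simp
  · simpa using length_le_decodePosNum u

/-- `decodeNat u = 0` only for `u = []`. [folklore] -/
theorem eq_nil_of_decodeNat_eq_zero (u : List Bool) (h : Computability.decodeNat u = 0) :
    u = [] := by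
  by_contra hne
  have h1 := length_le_decodeNat u
  rw [h] at h1
  exact hne (List.eq_nil_of_length_eq_zero (Nat.le_zero.1 h1))

/-- A pair string with NON-EMPTY second component is well formed: `|z| = 2|u| + 2 + |v|`.
[folklore] -/
theorem length_eq_of_boolUnpair_snd_ne_nil : ∀ z : List Bool, (boolUnpair z).2 ≠ [] →
    z.length = 2 * (boolUnpair z).1.length + 2 + (boolUnpair z).2.length
  | [], h => by simp [boolUnpair] at h
  | [b], h => by simp [boolUnpair] at h
  | b :: b' :: rest, h => by
    by_cases hb : b = b'
    · subst hb
      have h' : (boolUnpair rest).2 ≠ [] := by simpa [boolUnpair] using h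
      have ih := length_eq_of_boolUnpair_snd_ne_nil rest h'
      simp only [boolUnpair, if_true, List.length_cons]
      omega
    · cases b'
      · simp [boolUnpair, hb] at h
      · simp [boolUnpair, hb]; omega

/-- The strings that unpair to `([], [])`: length `≤ 1`, the junk cylinder `10{0,1}*`, or `01`.
[folklore] -/
theorem boolUnpair_eq_nil_nil : ∀ z : List Bool, boolUnpair z = ([], []) →
    z.length ≤ 2 ∨ ∃ w, z = true :: false :: w
  | [], _ => by simp
  | [b], _ => by simp
  | b :: b' :: rest, h => by
    by_cases hb : b = b'
    · subst hb
      simp [boolUnpair] at h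
    · cases b'
      · cases b
        · exact absurd rfl hb
        · exact Or.inr ⟨rest, rfl⟩
      · cases b
        · simp only [boolUnpair, Bool.false_eq_true, if_false, if_true, Prod.mk.injEq,
            true_and] at h
          subst h; simp
        · exact absurd rfl hb

/-- What a successful decoding says about the string: the first component decodes to the vertex
count `n` and the payload has exactly `n²` bits. [folklore] -/
theorem decode_eq_some {z : List Bool} {G : Σ n, SimpleGraph (Fin n)}
    (h : Literature.Computability.Complexity.encodingGraph.decode z = some G) :
    Computability.decodeNat (boolUnpair z).1 = G.1 ∧ (boolUnpair z).2.length = G.1 * G.1 := by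
  simp only [Literature.Computability.Complexity.encodingGraph, Computability.Encoding.sigmaBool,
    sigmaBoolDecode, Option.map_eq_some_iff] at h
  obtain ⟨G', hG', rfl⟩ := h
  refine ⟨rfl, ?_⟩
  simp only [encodingGraphFin, encodingBitVec, Option.map_eq_some_iff] at hG'
  obtain ⟨f, hf, -⟩ := hG'
  by_contra hlen
  rw [dif_neg hlen] at hf
  simp at hf

/-- FINITELY MANY STRINGS DECODE TO A GRAPH ON `1 ≤ n ≤ M` VERTICES: such a string is a well-formed
pair of total length `2|u| + 2 + n² ≤ 2M + 2 + M²`. [this work] -/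
theorem fewVertexCodes_finite (M : ℕ) :
    {z : List Bool | ∃ G : Σ n, SimpleGraph (Fin n),
      Literature.Computability.Complexity.encodingGraph.decode z = some G ∧ 1 ≤ G.1 ∧ G.1 ≤ M}.Finite := by
  refine (List.finite_length_le Bool (2 * M + 2 + M * M)).subset ?_
  rintro z ⟨G, hG, h1, hM⟩
  obtain ⟨hu, hv⟩ := decode_eq_some hG
  have hv' : (boolUnpair z).2 ≠ [] := by
    intro h
    rw [h, List.length_nil] at hv
    have : 1 ≤ G.1 * G.1 := Nat.one_le_iff_ne_zero.2 (Nat.mul_ne_zero (by omega) (by omega))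
    omega
  have hz := length_eq_of_boolUnpair_snd_ne_nil z hv'
  have hul : (boolUnpair z).1.length ≤ G.1 := hu ▸ length_le_decodeNat _
  have hmm : G.1 * G.1 ≤ M * M := Nat.mul_le_mul hM hM
  change z.length ≤ 2 * M + 2 + M * M
  omega

/-- THE `0`-VERTEX CODES ARE JUNK OR TINY: a string decoding to a graph on `Fin 0` unpairs to
`([], [])`, hence has length `≤ 2` or lies in the cylinder `10{0,1}*`. [this work] -/
theorem zeroVertexCodes_subset :
    {z : List Bool | ∃ G : Σ n, SimpleGraph (Fin n),
      Literature.Computability.Complexity.encodingGraph.decode z = some G ∧ G.1 = 0} ⊆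
      {z | z.length ≤ 2} ∪ {z | ∃ w, z = true :: false :: w} := by
  rintro z ⟨G, hG, h0⟩
  obtain ⟨hu, hv⟩ := decode_eq_some hG
  rw [h0] at hu hv
  have hu' := eq_nil_of_decodeNat_eq_zero _ hu
  have hv' : (boolUnpair z).2 = [] := List.eq_nil_of_length_eq_zero (by simpa using hv)
  have hpair : boolUnpair z = ([], []) := Prod.ext hu' hv'
  exact boolUnpair_eq_nil_nil z hpair

open scoped Classical in
/-- A VALID CODE ON `n` VERTICES HAS HARD-CORE COUNT AT LEAST `n` (for `p, q ≥ 1`): the `n`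
singletons are independent sets, each contributing `p · q^{n-1} ≥ 1`. [folklore] -/
theorem vertexCount_le_hardcoreSum {p q : ℕ} (hp : 0 < p) (hq : 0 < q) {n : ℕ}
    (G : SimpleGraph (Fin n)) :
    n ≤ ∑ I : Finset (Fin n),
      (if G.IsIndepSet (↑I : Set (Fin n)) then p ^ I.card * q ^ (n - I.card) else 0) := by
  set f : Finset (Fin n) → ℕ := fun I =>
    if G.IsIndepSet (↑I : Set (Fin n)) then p ^ I.card * q ^ (n - I.card) else 0 with hf
  have hsingle : ∀ v : Fin n, 1 ≤ f {v} := by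
    intro v
    have hind : G.IsIndepSet (↑({v} : Finset (Fin n)) : Set (Fin n)) := by
      rw [Finset.coe_singleton]
      exact Set.pairwise_singleton v _
    simp only [hf, if_pos hind, Finset.card_singleton]
    exact Nat.mul_pos (pow_pos hp _) (pow_pos hq _)
  calc n = ∑ _v : Fin n, 1 := by simp
    _ ≤ ∑ v : Fin n, f {v} := Finset.sum_le_sum fun v _ => hsingle v
    _ = ∑ I ∈ (Finset.univ : Finset (Fin n)).map ⟨({·} : Fin n → Finset (Fin n)),
          Finset.singleton_injective⟩, f I := by
        rw [Finset.sum_map]; rfl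
    _ ≤ ∑ I, f I := Finset.sum_le_sum_of_subset (Finset.subset_univ _)

/-- The crux's guard forces `0 < p`: `λ_c(Δ) = (Δ-1)^{Δ-1}/(Δ-2)^Δ > 0` for `Δ ≥ 3`, so
`p/q > 0`. [folklore] -/
theorem guard_pos {Δ p q : ℕ} (hΔ : 3 ≤ Δ)
    (hlam : ((Δ : ℝ) - 1) ^ (Δ - 1) / ((Δ : ℝ) - 2) ^ Δ < (p : ℝ) / q) : 0 < p := by
  have hΔ' : (3 : ℝ) ≤ Δ := by exact_mod_cast hΔ
  have h1 : (0 : ℝ) < ((Δ : ℝ) - 1) ^ (Δ - 1) := pow_pos (by linarith) _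
  have h2 : (0 : ℝ) < ((Δ : ℝ) - 2) ^ Δ := pow_pos (by linarith) _
  have hpos : (0 : ℝ) < (p : ℝ) / q := (div_pos h1 h2).trans hlam
  by_contra hp
  have hp0 : p = 0 := by omega
  subst hp0
  simp at hpos

/-! ## Consequences for witnesses: vertex counts and thresholds escape -/

open scoped Classical in
/-- VERTEX COUNTS ESCAPE TO INFINITY ON BOTH SIDES. For every witness-shaped triple with the
crux's `N` and every `M`, the event "the sample decodes to a graph on `≤ M` vertices" has vanishing
mass under `D₀ n` AND `D₁ n`: the `0`-vertex part is junk-or-tiny (`zeroVertexCodes_subset`,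
`junk_mass_tendsto_zero`, `finset_mass_tendsto_zero`), the `1 ≤ n ≤ M` part is a finite set
(`fewVertexCodes_finite`). The typed (index-free) clause (i) allows tiny instances, but they
must grow without bound. [this work] -/
theorem vertexCount_escapes (Δ p q : ℕ) (D₀ D₁ : Ensemble) (t : ℕ → ℕ)
    (hind : ∀ A : RandAlg (List Bool) Bool,
      A.IsPolyTime (id : List Bool → List Bool) Computability.encodeBool →
      Tendsto (fun n : ℕ => |(∑' x : List Bool, ((D₀ n) x).toReal * A.pr id x {b | b = true}) -
        (∑' x : List Bool, ((D₁ n) x).toReal * A.pr id x {b | b = true})|) atTop (𝓝 0))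
    (h₀ : Tendsto (fun n : ℕ => D₀.prob n {x | 8 * t n ≤ (match
        Literature.Computability.Complexity.encodingGraph.decode x with
        | none => 0
        | some G => if G.2.maxDegree ≤ Δ then ∑ I : Finset (Fin G.1),
            (if G.2.IsIndepSet (↑I : Set (Fin G.1)) then p ^ I.card * q ^ (G.1 - I.card) else 0)
          else 0)}) atTop (𝓝 1))
    (h₁ : Tendsto (fun n : ℕ => D₁.prob n {x | 0 < (match
        Literature.Computability.Complexity.encodingGraph.decode x with
        | none => 0
        | some G => if G.2.maxDegree ≤ Δ then ∑ I : Finset (Fin G.1),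
            (if G.2.IsIndepSet (↑I : Set (Fin G.1)) then p ^ I.card * q ^ (G.1 - I.card) else 0)
          else 0) ∧ (match Literature.Computability.Complexity.encodingGraph.decode x with
        | none => 0
        | some G => if G.2.maxDegree ≤ Δ then ∑ I : Finset (Fin G.1),
            (if G.2.IsIndepSet (↑I : Set (Fin G.1)) then p ^ I.card * q ^ (G.1 - I.card) else 0)
          else 0) ≤ t n}) atTop (𝓝 1)) (M : ℕ) :
    Tendsto (fun n => D₀.prob n {z | ∃ G : Σ n, SimpleGraph (Fin n),
        Literature.Computability.Complexity.encodingGraph.decode z = some G ∧ G.1 ≤ M}) atTop (𝓝 0) ∧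
      Tendsto (fun n => D₁.prob n {z | ∃ G : Σ n, SimpleGraph (Fin n),
        Literature.Computability.Complexity.encodingGraph.decode z = some G ∧ G.1 ≤ M}) atTop (𝓝 0) := by
  set N : List Bool → ℕ := fun x => (match
        Literature.Computability.Complexity.encodingGraph.decode x with
        | none => 0
        | some G => if G.2.maxDegree ≤ Δ then ∑ I : Finset (Fin G.1),
            (if G.2.IsIndepSet (↑I : Set (Fin G.1)) then p ^ I.card * q ^ (G.1 - I.card) else 0)
          else 0) with hN
  -- the three pieces
  set S : Set (List Bool) := {z | ∃ G : Σ n, SimpleGraph (Fin n),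
    Literature.Computability.Complexity.encodingGraph.decode z = some G ∧ G.1 ≤ M} with hS
  set T₂ : Set (List Bool) := {z | z.length ≤ 2} with hT₂
  set J : Set (List Bool) := {z | ∃ w, z = true :: false :: w} with hJ
  set F : Set (List Bool) := {z | ∃ G : Σ n, SimpleGraph (Fin n),
    Literature.Computability.Complexity.encodingGraph.decode z = some G ∧ 1 ≤ G.1 ∧ G.1 ≤ M} with hF
  have hsub : S ⊆ (T₂ ∪ J) ∪ F := by
    rintro z ⟨G, hG, hM⟩
    by_cases h0 : G.1 = 0
    · exact Or.inl (zeroVertexCodes_subset ⟨G, hG, h0⟩)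
    · exact Or.inr ⟨G, hG, by omega, hM⟩
  -- disjointness of the two events of clause (ii)
  have hUV : ∀ n, Disjoint {x | 8 * t n ≤ N x} {x | 0 < N x ∧ N x ≤ t n} := by
    intro n
    rw [Set.disjoint_left]
    rintro x (hx : 8 * t n ≤ N x) ⟨hpos, hle⟩
    omega
  have hT : Tendsto (fun n => D₀.prob n T₂) atTop (𝓝 0) ∧ Tendsto (fun n => D₁.prob n T₂) atTop (𝓝 0) :=
    shortStrings_mass_tendsto_zero D₀ D₁ hind _ _ hUV h₀ h₁ 2
  have hJm : Tendsto (fun n => D₀.prob n J) atTop (𝓝 0) ∧ Tendsto (fun n => D₁.prob n J) atTop (𝓝 0) :=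
    junk_mass_tendsto_zero Δ p q D₀ D₁ t hind h₀ h₁
  have hFm : Tendsto (fun n => D₀.prob n F) atTop (𝓝 0) ∧ Tendsto (fun n => D₁.prob n F) atTop (𝓝 0) := by
    have h := finset_mass_tendsto_zero D₀ D₁ hind _ _ hUV h₀ h₁ (fewVertexCodes_finite M).toFinset
    simpa only [Set.Finite.coe_toFinset] using h
  -- union bound and squeeze, for an arbitrary PMF sequence
  have key : ∀ D : Ensemble, Tendsto (fun n => D.prob n T₂) atTop (𝓝 0) →
      Tendsto (fun n => D.prob n J) atTop (𝓝 0) → Tendsto (fun n => D.prob n F) atTop (𝓝 0) →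
      Tendsto (fun n => D.prob n S) atTop (𝓝 0) := by
    intro D hT hJ hF
    have hup : Tendsto (fun n => D.prob n T₂ + D.prob n J + D.prob n F) atTop (𝓝 0) := by
      simpa using (hT.add hJ).add hF
    refine tendsto_of_tendsto_of_tendsto_of_le_of_le tendsto_const_nhds hup
      (fun n => Ensemble.prob_nonneg _ _ _) (fun n => ?_)
    calc D.prob n S ≤ D.prob n ((T₂ ∪ J) ∪ F) := mass_mono (D n) hsub
      _ ≤ D.prob n (T₂ ∪ J) + D.prob n F := mass_union_le (D n) _ _
      _ ≤ D.prob n T₂ + D.prob n J + D.prob n F := by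
          have := mass_union_le (D n) T₂ J
          change (PMF.toOuterMeasure (D n) (T₂ ∪ J)).toReal + _ ≤
            (PMF.toOuterMeasure (D n) T₂).toReal + (PMF.toOuterMeasure (D n) J).toReal + _
          linarith
  exact ⟨key D₀ hT.1 hJm.1 hFm.1, key D₁ hT.2 hJm.2 hFm.2⟩

open scoped Classical in
/-- THE THRESHOLD SEQUENCE TENDS TO INFINITY. For every witness-shaped triple with the crux's `N`
and `p, q ≥ 1` (`guard_pos`): `t n → ∞`. If `t n ≤ C` frequently, the NO-event
`{0 < N ≤ t n}` would sit inside "decodes to a graph on `≤ C` vertices" (a valid code on `m`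
vertices has `N ≥ m`, `vertexCount_le_hardcoreSum`; an invalid one has `N = 0`), an event of
vanishing `D₁`-mass by `vertexCount_escapes` — contradicting `D₁ n (NO-event) → 1`. [this work] -/
theorem threshold_tendsto_atTop (Δ p q : ℕ) (hp : 0 < p) (hq : 0 < q) (D₀ D₁ : Ensemble)
    (t : ℕ → ℕ)
    (hind : ∀ A : RandAlg (List Bool) Bool,
      A.IsPolyTime (id : List Bool → List Bool) Computability.encodeBool →
      Tendsto (fun n : ℕ => |(∑' x : List Bool, ((D₀ n) x).toReal * A.pr id x {b | b = true}) -
        (∑' x : List Bool, ((D₁ n) x).toReal * A.pr id x {b | b = true})|) atTop (𝓝 0))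
    (h₀ : Tendsto (fun n : ℕ => D₀.prob n {x | 8 * t n ≤ (match
        Literature.Computability.Complexity.encodingGraph.decode x with
        | none => 0
        | some G => if G.2.maxDegree ≤ Δ then ∑ I : Finset (Fin G.1),
            (if G.2.IsIndepSet (↑I : Set (Fin G.1)) then p ^ I.card * q ^ (G.1 - I.card) else 0)
          else 0)}) atTop (𝓝 1))
    (h₁ : Tendsto (fun n : ℕ => D₁.prob n {x | 0 < (match
        Literature.Computability.Complexity.encodingGraph.decode x with
        | none => 0
        | some G => if G.2.maxDegree ≤ Δ then ∑ I : Finset (Fin G.1),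
            (if G.2.IsIndepSet (↑I : Set (Fin G.1)) then p ^ I.card * q ^ (G.1 - I.card) else 0)
          else 0) ∧ (match Literature.Computability.Complexity.encodingGraph.decode x with
        | none => 0
        | some G => if G.2.maxDegree ≤ Δ then ∑ I : Finset (Fin G.1),
            (if G.2.IsIndepSet (↑I : Set (Fin G.1)) then p ^ I.card * q ^ (G.1 - I.card) else 0)
          else 0) ≤ t n}) atTop (𝓝 1)) :
    Tendsto t atTop atTop := by
  set N : List Bool → ℕ := fun x => (match
        Literature.Computability.Complexity.encodingGraph.decode x with
        | none => 0
        | some G => if G.2.maxDegree ≤ Δ then ∑ I : Finset (Fin G.1),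
            (if G.2.IsIndepSet (↑I : Set (Fin G.1)) then p ^ I.card * q ^ (G.1 - I.card) else 0)
          else 0) with hN
  -- a string of positive count decodes to a graph on at most `N` vertices
  have hcount : ∀ x, 0 < N x → ∃ G : Σ n, SimpleGraph (Fin n),
      Literature.Computability.Complexity.encodingGraph.decode x = some G ∧ G.1 ≤ N x := by
    intro x hx
    rcases hdec : Literature.Computability.Complexity.encodingGraph.decode x with _ | G
    · exfalso
      simp only [hN, hdec] at hx
      exact lt_irrefl 0 hx
    · refine ⟨G, rfl, ?_⟩
      simp only [hN, hdec] at hx ⊢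
      split_ifs at hx ⊢ with hdeg
      · exact vertexCount_le_hardcoreSum hp hq G.2
      · exact absurd hx (lt_irrefl 0)
  rw [tendsto_atTop]
  intro C
  have hsmall := (vertexCount_escapes Δ p q D₀ D₁ t hind h₀ h₁ C).2
  have e1 := h₁.eventually_const_lt (show (1 / 2 : ℝ) < 1 by norm_num)
  have e2 := hsmall.eventually_lt_const (show (0 : ℝ) < 1 / 2 by norm_num)
  filter_upwards [e1, e2] with n hn1 hn2
  by_contra hC
  have hC' : t n < C := not_le.1 hC
  have hsub : {x | 0 < N x ∧ N x ≤ t n} ⊆ {z | ∃ G : Σ n, SimpleGraph (Fin n),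
      Literature.Computability.Complexity.encodingGraph.decode z = some G ∧ G.1 ≤ C} := by
    rintro x ⟨hpos, hle⟩
    obtain ⟨G, hG, hGN⟩ := hcount x hpos
    exact ⟨G, hG, by omega⟩
  have hmono := mass_mono (D₁ n) hsub
  change (1 / 2 : ℝ) < (PMF.toOuterMeasure (D₁ n) {x | 0 < N x ∧ N x ≤ t n}).toReal at hn1
  change (PMF.toOuterMeasure (D₁ n) _).toReal < 1 / 2 at hn2
  linarith

open scoped Classical in
/-- SANITY LINK / SUMMARY: the hypotheses of the theorems of this cycle are literally the clauses
of the crux, so EVERY witness `(Δ, p, q, D₀, D₁, t)` of `PseudorandomTwinsAbove` has: `0 < p`;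
thresholds `t n → ∞`; vanishing mass, on BOTH sides, of every finite set of strings, of the codes
of graphs with boundedly many vertices, and of the junk cylinder `10{0,1}*`; asymptotically equal
mass of every regular language; and length laws merging in total variation. (Hypothesis = the
crux; the conclusion asserts no route statement.) [this work] -/
theorem witness_constraints (h : Summit.PneNP.PneNP.Theses.PhaseTwins.PseudorandomTwinsAbove) :
    ∃ (p q : ℕ) (D₀ D₁ : Ensemble) (t : ℕ → ℕ), 0 < p ∧ 0 < q ∧ Tendsto t atTop atTop ∧
      (∀ Φ : Finset (List Bool),
        Tendsto (fun n => D₀.prob n ↑Φ) atTop (𝓝 0) ∧ Tendsto (fun n => D₁.prob n ↑Φ) atTop (𝓝 0)) ∧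
      (∀ M : ℕ, Tendsto (fun n => D₀.prob n {z | ∃ G : Σ n, SimpleGraph (Fin n),
          Literature.Computability.Complexity.encodingGraph.decode z = some G ∧ G.1 ≤ M}) atTop (𝓝 0) ∧
        Tendsto (fun n => D₁.prob n {z | ∃ G : Σ n, SimpleGraph (Fin n),
          Literature.Computability.Complexity.encodingGraph.decode z = some G ∧ G.1 ≤ M}) atTop (𝓝 0)) ∧
      (Tendsto (fun n => D₀.prob n {x | ∃ w, x = true :: false :: w}) atTop (𝓝 0) ∧
        Tendsto (fun n => D₁.prob n {x | ∃ w, x = true :: false :: w}) atTop (𝓝 0)) ∧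
      (∀ {σ : Type} [Fintype σ] (M : DFA Bool σ), Tendsto (fun n =>
        |D₀.prob n {x | M.eval x ∈ M.accept} - D₁.prob n {x | M.eval x ∈ M.accept}|) atTop (𝓝 0)) ∧
      (∀ ε : ℝ, 0 < ε → ∀ᶠ n in atTop, ∀ T : Set ℕ,
        |D₀.prob n {x | x.length ∈ T} - D₁.prob n {x | x.length ∈ T}| ≤ ε) := by
  obtain ⟨Δ, p, q, hΔ, hq, hlam, D₀, D₁, -, -, hind, t, h₀, h₁⟩ := h
  have hp := guard_pos hΔ hlam
  have hUV : ∀ n, Disjoint {x | 8 * t n ≤ (match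
        Literature.Computability.Complexity.encodingGraph.decode x with
        | none => 0
        | some G => if G.2.maxDegree ≤ Δ then ∑ I : Finset (Fin G.1),
            (if G.2.IsIndepSet (↑I : Set (Fin G.1)) then p ^ I.card * q ^ (G.1 - I.card) else 0)
          else 0)}
      {x | 0 < (match Literature.Computability.Complexity.encodingGraph.decode x with
        | none => 0
        | some G => if G.2.maxDegree ≤ Δ then ∑ I : Finset (Fin G.1),
            (if G.2.IsIndepSet (↑I : Set (Fin G.1)) then p ^ I.card * q ^ (G.1 - I.card) else 0)
          else 0) ∧ (match Literature.Computability.Complexity.encodingGraph.decode x with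
        | none => 0
        | some G => if G.2.maxDegree ≤ Δ then ∑ I : Finset (Fin G.1),
            (if G.2.IsIndepSet (↑I : Set (Fin G.1)) then p ^ I.card * q ^ (G.1 - I.card) else 0)
          else 0) ≤ t n} := by
    intro n
    rw [Set.disjoint_left]
    rintro x (hx : 8 * t n ≤ _) ⟨hpos, hle⟩
    omega
  exact ⟨p, q, D₀, D₁, t, hp, hq, threshold_tendsto_atTop Δ p q hp hq D₀ D₁ t hind h₀ h₁,
    finset_mass_tendsto_zero D₀ D₁ hind _ _ hUV h₀ h₁,
    vertexCount_escapes Δ p q D₀ D₁ t hind h₀ h₁, junk_mass_tendsto_zero Δ p q D₀ D₁ t hind h₀ h₁,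
    fun M => dfa_merge D₀ D₁ hind M, fun ε hε => lengthLaws_tv_merge D₀ D₁ hind hε⟩

end

end Summit.PneNP.PneNP.Theorems.PseudorandomTwinsAbove.Negative
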